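import Summits.BirchSwinnertonDyer.BirchSwinnertonDyer.Theorems.PrintX9MuPartSpecWitnessDefs
import Literature.NumberTheory.EllipticCurves.IwasawaAlgebraSpecializationIndexProofs
import Literature.NumberTheory.EllipticCurves.IwasawaAlgebraSpecializationTorsionBoundProofs
import HarnessLib
/-!
# The shared μ-residual `MuPartStabilizedOfPrint` FROM SPECIALISED WITNESSES: `SpecWitnessesFrameFree →
# MuPartStabilizedOfPrint` (module algebra L0–L2 + the landed `q_m`-asymptotics; proofs file)

Cell `pub/bsd-print-x9`, seat `bsd-line-x9-p1-w2` (g4), for the μ-LEAD lineage `bsd-line-x9-p1` (crux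
stmt-BirchSwinnertonDyer-27077; skeleton v7's one stub is the shared letter). THEOREMS ONLY; no definition,
no named fact, no `sorry`; ROUTE-INDEPENDENT (imports no `Theses` file). Transcribed into the importable tree
from bsd-idea-16's crux workfile `Cruxes/HowardContainmentAnyClassNumberX10b/Lines/specialise_first_mu_x10b.lean`
§6/§8 (card `specialise-first-mu-x10b` v7; proofs by bsd-idea-16 g4, re-homed here with the namespace of
the shared letter); design credit: bsd-idea-16.

WHAT.
* L0 `quotSMulTopMap_torsion_injective`: for a domain `R`, `q ≠ 0`: `X_tors/qX_tors ↪ X/qX`.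
* L1 `card_le_card_ker_mul_card_torsion`: `#A ≤ #ker h · #C_tors` for `A` finite injecting into the source
  of a linear `h` with finite kernel.
* L2 `card_quot_span_singleton_le`: `#(H/R∙κ₁) ≤ #coker f · #((S/L)/I(S/L))` when `I•H = 0`, `f(L) ⊆ R∙κ₁`.
* `card_quot_torsion_le_of_specWitness`: one witness at `q` gives `#(X_tors/q) ≤ c³ · #((S/L)/q)²`.
* `exists_card_bound_of_specWitnesses`: `HasSpecWitnesses p S X L` gives the `m`-uniform specialised
  inequality (the hypothesis of `IwasawaAlgebra.lengthAt_le_two_mul_of_card_quotSMulTop_qm_le`, x10b-p1 p625052).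
* **`lengthAt_torsion_le_two_mul_of_hasSpecWitnesses`** — the ONE POINTWISE theorem (bsd-idea-16 g5's cut):
  `S`, `X` f.g., `S/L` torsion, `HasSpecWitnesses p S X L` ⟹ `length_(p)(X_tors) ≤ 2 · length_(p)(S/L)`.
* the three letter SHELLS: **`muPartStabilizedOfPrint_of_specWitnessesFrameFree`** (`∀ C` letter, p625984),
  **`muPartStabilizedCoherentPair_of_specWitnessesCoherentPair`** (L∃, p630902 — the μ-LEAD's endorsed crux
  text, 11:53:02Z) and **`muPartStabilizedPrincipal_of_specWitnessesPrincipal`** (LP, p630902): ONE `SpecWitness`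
  construction (D1) closes whichever letter plan g10 installs, for rows 9 AND 10, BY NAME (then crux 27077 via
  `PrintX9SharpMuStabilized.howardContainmentLightFramePinnedOfPrintSharp_of_muPartStabilizedOfPrint` p626629 /
  `PrintX9SharpMuCoherentPair.…_of_muPartStabilizedCoherentPair`, and 27275 / 23055 via their landed closers).
HONEST FRAMING: none of the shells is proved anywhere (they are the port's deliverable: S1 cardinality-bounded
control at `q_m` + S2 error-free DVR Kolyvagin bound, beyond citable print at `p ∣ h_K`, REF-118); this file
only records, in the kernel, that each suffices for its letter. «beyond-print theorem»: no. BSD is not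
proved by any of this; no summit statement is proved by this seat.

References: [Howard2004HeegnerKolyvagin] proof of Thm. 2.2.10 (𝔮 = T^m + p), Lemma 2.2.7 / Prop. 2.2.8;
[MastellaZerman2026] Thm. 2.40; [Washington1997] §13.2.
-/

set_option linter.dupNamespace false
set_option autoImplicit false

noncomputable section

open scoped Classical

open Literature Literature.NumberTheory.EllipticCurves WeierstrassCurve

namespace Summit.BirchSwinnertonDyer.BirchSwinnertonDyer.Theorems.HeegnerMuPartStabilized

/-! ## L0–L2: module algebra (any commutative ring) -/

section Bookkeeping

variable {R : Type*} [CommRing R]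

/-- **L0 (Tor-vanishing).** For a domain `R`, `q ≠ 0` and `N = X_tors`, the natural map `N/qN → X/qX` is
injective: if `n = q • y` with `n` torsion then `y` is torsion (`(X/N)[q] = 0`, `X/N` being torsion-free).
[cite: Washington1997, §13.2] [cite: Howard2004HeegnerKolyvagin, proof of Thm. 2.2.10 (𝔮 = T^m + p)] -/
theorem quotSMulTopMap_torsion_injective [IsDomain R] {X : Type*} [AddCommGroup X] [Module R X]
    {q : R} (hq : q ≠ 0) :
    Function.Injective (quotSMulTopMap (Ideal.span {q}) (Submodule.torsion R X)) := by
  rw [injective_iff_map_eq_zero]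
  intro x hx
  obtain ⟨n, rfl⟩ := Submodule.Quotient.mk_surjective _ x
  rw [quotSMulTopMap_mk, Submodule.Quotient.mk_eq_zero, Submodule.ideal_span_singleton_smul,
    Submodule.mem_smul_pointwise_iff_exists] at hx
  obtain ⟨y, -, hy⟩ := hx
  have hy_tors : y ∈ Submodule.torsion R X := by
    obtain ⟨a, ha⟩ := (Submodule.mem_torsion_iff (n : X)).1 n.2
    refine (Submodule.mem_torsion_iff y).2 ⟨a * ⟨q, mem_nonZeroDivisors_of_ne_zero hq⟩, ?_⟩
    rw [Submonoid.smul_def, Submonoid.coe_mul, mul_smul, hy, ← Submonoid.smul_def]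
    exact ha
  rw [Submodule.Quotient.mk_eq_zero, Submodule.ideal_span_singleton_smul,
    Submodule.mem_smul_pointwise_iff_exists]
  refine ⟨⟨y, hy_tors⟩, Submodule.mem_top, ?_⟩
  apply Subtype.ext
  simpa using hy

/-- **L1 (torsion transport along control maps).** If `ι : A → B` is an injective linear map from a FINITE
module `A` and `h : B → C` is linear with finite kernel, then `#A ≤ #ker h · #(ℤ-torsion of C)`: the
composite `h ∘ ι` has kernel embedding into `ker h` and image inside the torsion subgroup of `C`. Only the
CARDINALITY of `ker h` enters. [cite: Washington1997, §13.2] [cite: Howard2004HeegnerKolyvagin, Prop. 2.2.8] -/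
theorem card_le_card_ker_mul_card_torsion {A B C : Type*} [AddCommGroup A] [Module R A]
    [AddCommGroup B] [Module R B] [AddCommGroup C] [Module R C]
    (ι : A →ₗ[R] B) (hι : Function.Injective ι) (h : B →ₗ[R] C) [Finite A]
    [Finite (LinearMap.ker h)] [Finite (AddCommGroup.torsion C)] :
    Nat.card A ≤ Nat.card (LinearMap.ker h) * Nat.card (AddCommGroup.torsion C) := by
  set g : A →ₗ[R] C := h ∘ₗ ι with hg
  have h1 : Nat.card A = Nat.card (LinearMap.ker g) * Nat.card (LinearMap.range g) := by
    rw [Submodule.card_eq_card_quotient_mul_card (LinearMap.ker g),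
      Nat.card_congr (LinearMap.quotKerEquivRange g).toEquiv]
  have h2 : Nat.card (LinearMap.ker g) ≤ Nat.card (LinearMap.ker h) := by
    refine Nat.card_le_card_of_injective
      (fun x => ⟨ι x.1, by
        have hx : g x.1 = 0 := LinearMap.mem_ker.1 x.2
        exact LinearMap.mem_ker.2 (by simpa only [hg, LinearMap.comp_apply] using hx)⟩) ?_
    intro x y hxy
    apply Subtype.ext
    apply hι
    simpa using congrArg Subtype.val hxy
  have h3 : Nat.card (LinearMap.range g) ≤ Nat.card (AddCommGroup.torsion C) := by
    refine Nat.card_le_card_of_injective (fun x => ⟨x.1, ?_⟩) ?_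
    · obtain ⟨a, ha⟩ := LinearMap.mem_range.1 x.2
      rw [← ha]
      exact g.toAddMonoidHom.isOfFinAddOrder (isOfFinAddOrder_of_finite a)
    · intro x y hxy
      apply Subtype.ext
      simpa using congrArg Subtype.val hxy
  rw [h1]
  exact Nat.mul_le_mul h2 h3

/-- **L2 (index transport for the Heegner class).** Let `f : S → H` be linear with FINITE cokernel,
`I • H = 0`, `L ≤ S` a submodule with `f(L) ⊆ R ∙ κ₁`. Then
`#(H ⧸ R∙κ₁) ≤ #(H ⧸ range f) · #((S ⧸ L) ⧸ I•(S ⧸ L))` (third isomorphism theorem twice; only the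
CARDINALITY of `coker f` enters). [cite: Washington1997, §13.2] [cite: Howard2004HeegnerKolyvagin, proof of Thm. 2.2.10 (𝔮 = T^m + p)] -/
theorem card_quot_span_singleton_le {S H : Type*} [AddCommGroup S] [Module R S]
    [AddCommGroup H] [Module R H] (f : S →ₗ[R] H) (L : Submodule R S) (I : Ideal R) (κ₁ : H)
    (hI : I • (⊤ : Submodule R H) = ⊥) (hL : L.map f ≤ R ∙ κ₁)
    [Finite (H ⧸ LinearMap.range f)] [Finite ((S ⧸ L) ⧸ (I • (⊤ : Submodule R (S ⧸ L))))] :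
    Nat.card (H ⧸ (R ∙ κ₁)) ≤
      Nat.card (H ⧸ LinearMap.range f) * Nat.card ((S ⧸ L) ⧸ (I • (⊤ : Submodule R (S ⧸ L)))) := by
  set K₁ : Submodule R H := R ∙ κ₁ with hK₁
  set A : Submodule R H := LinearMap.range f with hA
  rw [← Submodule.card_quotient_mul_card_quotient (A ⊔ K₁) K₁ le_sup_right, mul_comm]
  apply Nat.mul_le_mul
  · -- `#(H ⧸ (A ⊔ K₁)) ≤ #(H ⧸ A)` along the surjection `factor`.
    refine Nat.card_le_card_of_surjective (Submodule.factor (le_sup_left : A ≤ A ⊔ K₁)) ?_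
    intro x
    obtain ⟨y, rfl⟩ := Submodule.Quotient.mk_surjective _ x
    exact ⟨Submodule.Quotient.mk y, rfl⟩
  · -- `(A ⊔ K₁)/K₁ = range (mkQ ∘ f)`, a quotient of `S ⧸ (L ⊔ I•S) ≅ (S ⧸ L) ⧸ I•(S ⧸ L)`.
    have hmap : (A ⊔ K₁).map K₁.mkQ = LinearMap.range (K₁.mkQ ∘ₗ f) := by
      rw [Submodule.map_sup, Submodule.mkQ_map_self, sup_bot_eq, LinearMap.range_comp, hA]
    have hker : L ⊔ I • (⊤ : Submodule R S) ≤ LinearMap.ker (K₁.mkQ ∘ₗ f) := by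
      refine sup_le ?_ ?_
      · intro x hx
        rw [LinearMap.mem_ker, LinearMap.comp_apply, Submodule.mkQ_apply,
          Submodule.Quotient.mk_eq_zero]
        exact hL ⟨x, hx, rfl⟩
      · rw [Submodule.smul_le]
        intro a ha x _
        rw [LinearMap.mem_ker, LinearMap.comp_apply, Submodule.mkQ_apply,
          Submodule.Quotient.mk_eq_zero, map_smul]
        have : a • f x ∈ I • (⊤ : Submodule R H) := Submodule.smul_mem_smul ha Submodule.mem_top
        rw [hI, Submodule.mem_bot] at this
        rw [this]
        exact zero_mem _
    have hquot : (L ⊔ I • (⊤ : Submodule R S)).map L.mkQ = I • (⊤ : Submodule R (S ⧸ L)) := by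
      rw [Submodule.map_sup, Submodule.mkQ_map_self, bot_sup_eq, Submodule.map_smul'',
        Submodule.map_top, Submodule.range_mkQ]
    have e : ((S ⧸ L) ⧸ (I • (⊤ : Submodule R (S ⧸ L)))) ≃ₗ[R] S ⧸ (L ⊔ I • (⊤ : Submodule R S)) :=
      (Submodule.quotEquivOfEq _ _ hquot.symm) ≪≫ₗ
        Submodule.quotientQuotientEquivQuotient L (L ⊔ I • ⊤) le_sup_left
    haveI : Finite (S ⧸ (L ⊔ I • (⊤ : Submodule R S))) := Finite.of_equiv _ e.toEquiv
    rw [hmap, ← Nat.card_congr (LinearMap.quotKerEquivRange (K₁.mkQ ∘ₗ f)).toEquiv,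
      Nat.card_congr e.toEquiv]
    refine Nat.card_le_card_of_surjective (Submodule.factor hker) ?_
    intro x
    obtain ⟨y, rfl⟩ := Submodule.Quotient.mk_surjective _ x
    exact ⟨Submodule.Quotient.mk y, rfl⟩

/-- **The specialised inequality at one level from a witness.** `#(𝒳_tors / q 𝒳_tors) ≤ c³ · #((𝔖/L)/q)²`
— L0 + L1 + the witness's S2 field + L2 (with the control constants entering by cardinality).
[cite: Howard2004HeegnerKolyvagin, proof of Thm. 2.2.10 (𝔮 = T^m + p)] [cite: MastellaZerman2026, Thm. 2.40] -/
theorem card_quot_torsion_le_of_specWitness [IsDomain R] {S X : Type*} [AddCommGroup S]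
    [Module R S] [AddCommGroup X] [Module R X] {L : Submodule R S} {q : R} (hq : q ≠ 0) {c : ℕ}
    (w : SpecWitness R S X L q c)
    [Finite (Submodule.torsion R X ⧸
      ((Ideal.span {q} : Ideal R) • (⊤ : Submodule R (Submodule.torsion R X))))]
    [Finite ((S ⧸ L) ⧸ ((Ideal.span {q} : Ideal R) • (⊤ : Submodule R (S ⧸ L))))] :
    Nat.card (Submodule.torsion R X ⧸
        ((Ideal.span {q} : Ideal R) • (⊤ : Submodule R (Submodule.torsion R X)))) ≤
      c ^ 3 * Nat.card ((S ⧸ L) ⧸ ((Ideal.span {q} : Ideal R) • (⊤ : Submodule R (S ⧸ L)))) ^ 2 := by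
  letI := w.addCommGroupH
  letI := w.moduleH
  letI := w.addCommGroupXq
  letI := w.moduleXq
  haveI := w.finite_ker
  haveI := w.finite_torsion
  haveI := w.finite_coker
  haveI := w.finite_quot
  have h1 := card_le_card_ker_mul_card_torsion (quotSMulTopMap (Ideal.span {q}) (Submodule.torsion R X))
    (quotSMulTopMap_torsion_injective hq) w.h
  have h2 := card_quot_span_singleton_le w.f L (Ideal.span {q}) w.κ₁ w.smul_top_eq_bot w.map_le
  calc _ ≤ Nat.card (LinearMap.ker w.h) * Nat.card (AddCommGroup.torsion w.Xq) := h1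
    _ ≤ c * Nat.card (w.H ⧸ (R ∙ w.κ₁)) ^ 2 := Nat.mul_le_mul w.card_ker_le w.card_torsion_le_sq
    _ ≤ c * (c * Nat.card ((S ⧸ L) ⧸ ((Ideal.span {q} : Ideal R) • (⊤ : Submodule R (S ⧸ L))))) ^ 2 :=
        Nat.mul_le_mul_left _ (Nat.pow_le_pow_left (le_trans h2 (Nat.mul_le_mul_right _ w.card_coker_le)) 2)
    _ = _ := by ring

end Bookkeeping

/-! ## The `m`-uniform specialised inequality from witnesses at all large `m`, and the μ-residual BY NAME -/

/-- **Witnesses at all large `m` ⟹ the uniform specialised inequality** (binder-free core): for `S`, `X`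
f.g. over `Λ`, `L ≤ S` with `S/L` torsion, witnesses at `q_m = T^m + p` with constant `p^c` for `m ≥ m₀`
give `#(X_tors/q_m) ≤ p^{3c} · #((S/L)/q_m)²` for all large `m` (finiteness of both sides from the landed
`IwasawaAlgebra.exists_card_quotSMulTop_qm_bounds`). [cite: Howard2004HeegnerKolyvagin, proof of Thm. 2.2.10 (𝔮 = T^m + p)] -/
theorem exists_card_bound_of_specWitnesses (p : ℕ) [Fact p.Prime] {S X : Type} [AddCommGroup S]
    [Module (IwasawaAlgebra p) S] [AddCommGroup X] [Module (IwasawaAlgebra p) X]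
    [Module.Finite (IwasawaAlgebra p) S] [Module.Finite (IwasawaAlgebra p) X]
    (L : Submodule (IwasawaAlgebra p) S) (hL : Module.IsTorsion (IwasawaAlgebra p) (S ⧸ L))
    (hW : HasSpecWitnesses p S X L) :
    ∃ c m₀ : ℕ, ∀ m : ℕ, m₀ ≤ m →
      Nat.card (↥(Submodule.torsion (IwasawaAlgebra p) X) ⧸
        (Ideal.span {(PowerSeries.X ^ m + PowerSeries.C (p : ℤ_[p]) : IwasawaAlgebra p)} • ⊤ :
          Submodule (IwasawaAlgebra p) ↥(Submodule.torsion (IwasawaAlgebra p) X))) ≤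
      p ^ c * Nat.card ((S ⧸ L) ⧸
        (Ideal.span {(PowerSeries.X ^ m + PowerSeries.C (p : ℤ_[p]) : IwasawaAlgebra p)} • ⊤ :
          Submodule (IwasawaAlgebra p) (S ⧸ L))) ^ 2 := by
  haveI : IsNoetherian (IwasawaAlgebra p) X := isNoetherian_of_isNoetherianRing_of_finite _ _
  haveI : Module.Finite (IwasawaAlgebra p) (Submodule.torsion (IwasawaAlgebra p) X) := inferInstance
  haveI : Module.Finite (IwasawaAlgebra p) (S ⧸ L) := inferInstance
  obtain ⟨c, m₀, hw⟩ := hW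
  obtain ⟨B, m₁, -, h1⟩ := IwasawaAlgebra.exists_card_quotSMulTop_qm_bounds p _
    (Submodule.torsion_isTorsion (R := IwasawaAlgebra p) (M := X))
  obtain ⟨B', m₂, -, h2⟩ := IwasawaAlgebra.exists_card_quotSMulTop_qm_bounds p _ hL
  refine ⟨3 * c, max m₀ (max m₁ m₂), fun m hm => ?_⟩
  obtain ⟨w⟩ := hw m (le_trans (le_max_left _ _) hm)
  haveI := (h1 m (le_trans (le_trans (le_max_left _ _) (le_max_right _ _)) hm)).1
  haveI := (h2 m (le_trans (le_trans (le_max_right _ _) (le_max_right _ _)) hm)).1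
  calc _ ≤ _ := card_quot_torsion_le_of_specWitness (IwasawaAlgebra.X_pow_add_C_ne_zero p m) w
    _ = _ := by rw [← pow_mul, mul_comm c 3]

/-- **THE POINTWISE THEOREM (bsd-idea-16 g5's cut): `HasSpecWitnesses` ⟹ the μ-inequality at `(p)`.** For
`Λ`-modules `S ⊇ L` and `X` with `S`, `X` finitely generated and `S/L` torsion: witnesses at all large `q_m`
with an `m`-uniform constant give `length_{Λ_(p)}((X_tors)_(p)) ≤ 2 · length_{Λ_(p)}((S/L)_(p))`
(`exists_card_bound_of_specWitnesses` + the landed `IwasawaAlgebra.lengthAt_le_two_mul_of_card_quotSMulTop_qm_le`,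
x10b-p1 p625052). No frame, no letter, no quantifier over `C`.
[cite: Howard2004HeegnerKolyvagin, proof of Thm. 2.2.10 (𝔮 = T^m + p)] [cite: Washington1997, §13.2] -/
theorem lengthAt_torsion_le_two_mul_of_hasSpecWitnesses (p : ℕ) [Fact p.Prime] {S X : Type}
    [AddCommGroup S] [Module (IwasawaAlgebra p) S] [AddCommGroup X] [Module (IwasawaAlgebra p) X]
    [Module.Finite (IwasawaAlgebra p) S] [Module.Finite (IwasawaAlgebra p) X]
    (L : Submodule (IwasawaAlgebra p) S) (hL : Module.IsTorsion (IwasawaAlgebra p) (S ⧸ L))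
    (hW : HasSpecWitnesses p S X L)
    (𝔭 : PrimeSpectrum (IwasawaAlgebra p)) (h𝔭 : 𝔭.asIdeal = Ideal.span {(p : IwasawaAlgebra p)}) :
    Module.lengthAt (IwasawaAlgebra p) (Submodule.torsion (IwasawaAlgebra p) X) 𝔭 ≤
      2 * Module.lengthAt (IwasawaAlgebra p) (S ⧸ L) 𝔭 := by
  haveI : IsNoetherian (IwasawaAlgebra p) X := isNoetherian_of_isNoetherianRing_of_finite _ _
  haveI : Module.Finite (IwasawaAlgebra p) (Submodule.torsion (IwasawaAlgebra p) X) := inferInstance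
  haveI : Module.Finite (IwasawaAlgebra p) (S ⧸ L) := inferInstance
  exact IwasawaAlgebra.lengthAt_le_two_mul_of_card_quotSMulTop_qm_le p _ _
    (Submodule.torsion_isTorsion (R := IwasawaAlgebra p) (M := X)) hL
    (exists_card_bound_of_specWitnesses p L hL hW) 𝔭 h𝔭

/-! ## The three letter shells -/

/-- **Shell ⟹ `∀ C` letter**: `SpecWitnessesFrameFree → MuPartStabilizedOfPrint` (p625984), BY NAME. ONE `SpecWitness`
construction under the `∀ C` binders closes the shared μ-residual of rows 9 AND 10 in its strongest spelling.
[cite: Howard2004HeegnerKolyvagin, proof of Thm. 2.2.10 (𝔮 = T^m + p)] [cite: MastellaZerman2026, Thm. 2.40] -/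
theorem muPartStabilizedOfPrint_of_specWitnessesFrameFree (hW : SpecWitnessesFrameFree) :
    MuPartStabilizedOfPrint := by
  intro N _ W _ K _ _ p _ κ γ jbar hyp hcm hirr hirrK hsc hHp hhK D C X hfinS hfinX htorC 𝔭 h𝔭
  haveI := hfinS
  haveI := hfinX
  exact lengthAt_torsion_le_two_mul_of_hasSpecWitnesses p _ htorC
    (hW N W K p κ γ jbar hyp hcm hirr hirrK hsc hHp hhK D C X hfinS hfinX htorC) 𝔭 h𝔭

/-- **Shell ⟹ coherent-pair letter L∃**: `SpecWitnessesCoherentPair → MuPartStabilizedCoherentPair` (p630902;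
the μ-LEAD's endorsed crux text). The D1 constructor exports its own `(C, F)` and witnesses AT THAT `C`; no
`∀ C` transfer debt. [cite: Howard2004HeegnerKolyvagin, proof of Thm. 2.2.10 (𝔮 = T^m + p)] [cite: MastellaZerman2026, Thm. 2.40] -/
theorem muPartStabilizedCoherentPair_of_specWitnessesCoherentPair (hW : SpecWitnessesCoherentPair) :
    MuPartStabilizedCoherentPair := by
  intro N _ W _ K _ _ p _ κ γ jbar hyp hcm hirr hirrK hsc hHp hhK hpN hTw1 hcardp Dt β hβ D X
  obtain ⟨C, F, hCDt, hFDt, hCβ, hFβ, hfwd, hrev, hWit⟩ :=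
    hW N W K p κ γ jbar hyp hcm hirr hirrK hsc hHp hhK hpN hTw1 hcardp Dt β hβ D X
  refine ⟨C, F, hCDt, hFDt, hCβ, hFβ, hfwd, hrev, fun hfinS hfinX htorC 𝔭 h𝔭 => ?_⟩
  haveI := hfinS
  haveI := hfinX
  exact lengthAt_torsion_le_two_mul_of_hasSpecWitnesses p _ htorC (hWit hfinS hfinX htorC) 𝔭 h𝔭

/-- **Shell ⟹ principal-system letter LP**: `SpecWitnessesPrincipal → MuPartStabilizedPrincipal` (p630902).
[cite: Howard2004HeegnerKolyvagin, proof of Thm. 2.2.10 (𝔮 = T^m + p)] [cite: MastellaZerman2026, Thm. 2.40] -/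
theorem muPartStabilizedPrincipal_of_specWitnessesPrincipal (hW : SpecWitnessesPrincipal) :
    MuPartStabilizedPrincipal := by
  intro N _ W _ K _ _ p _ κ γ jbar hyp hcm hirr hirrK hsc hHp hhK D C X x A hx hfix hA hu hv hfinS hfinX htorC 𝔭 h𝔭
  haveI := hfinS
  haveI := hfinX
  exact lengthAt_torsion_le_two_mul_of_hasSpecWitnesses p _ htorC
    (hW N W K p κ γ jbar hyp hcm hirr hirrK hsc hHp hhK D C X x A hx hfix hA hu hv hfinS hfinX htorC) 𝔭 h𝔭

end Summit.BirchSwinnertonDyer.BirchSwinnertonDyer.Theorems.HeegnerMuPartStabilized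

end
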